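import Literature.NumberTheory.LFunctions.Zhang2022.Section10cTop1422Int
import Literature.NumberTheory.LFunctions.Zhang2022.TypedSection12CExact
import Literature.NumberTheory.LFunctions.Zhang2022.Section12Ded1217ErrorTerms

/-!
# Zhang (2022) §12 p. 73: the top-range profile of `S_j(𝐚₁₅,𝐚₂₂)` in the EXACT reading — `𝓖_{jμ}(P^θ/t)·𝓦*ˣ_j(t)`
# as a function of `t`, its `(M, M′/t)` bounds and its value at `t = P^z`

Topic `Literature/NumberTheory/LFunctions/Zhang2022` (Landau–Siegel audit tree; verdict-neutral).
Y. Zhang, *Discrete mean estimates and the Landau–Siegel zero*, arXiv:2211.02515v1 (2022)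
[Zhang2022LandauSiegel]. **Status of the source: an unrefereed manuscript under adjudication**; everything in this
file is PROVED (theorems only; no new definitions, no new facts); nothing here is a claim about Theorems 1–2 of the
source or about Landau–Siegel zeros.

The node of record `Typed.Sec12C.Top1522Ex` (R-18; §12.u049, p. 73, tex L3694–L3702, with Zhang's own `𝓦*_j` of
the proof of Lemma 12.1 kept exact: `frakwStarEx c′ D j y = (y/P″₁)^{−β₆}(−1 + (β₆ − β_j)log(y/P″₁))`) asserts the
top range of `S_j(𝐚₁₅,𝐚₂₂)` equals the `z`-integral `main12u049intEx`; its printed first line is the `n`-sum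
`main12u049sumEx` over the window `P^{0.496} < n < P^θ` (`θ = 0.498, 0.5`) with weight `𝓖_{jμ}(P^θ/n)·𝓦*ˣ_j(n)`. This
file supplies, for the passage sum → integral by the §8 evaluation rule `Typed.Sec10C.lamAvg_rule` (template:
`Section10cProfiles`/`Section10cTop1422Int` of the §10 top range), the PROFILE data:

* `frakwStarEx_eq_exp` — for `t > 0`, `𝓦*ˣ_j(t) = e^{−β₆ log(t/P″₁)}(−1 + (β₆ − β_j)log(t/P″₁))` (the power as an
  exponential; `β₆ ∈ iℝ` so the first factor has modulus `1`);
* `one_le_P1pp`, `P1pp_le_bigP` — `1 ≤ P″₁ ≤ P` once `𝓛 ≥ 3`;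
* `weightEx_bounds` — on `[1, P]`: `t ↦ 𝓦*ˣ_j(t)` (exponential form) is differentiable, `‖·‖ ≤ 1 + 7π`,
  `‖d/dt‖ ≤ α(3(1 + 7π) + 7)/t` (`‖β₆‖ ≤ 3α`, `‖β_j‖ ≤ 4α`, `|log(t/P″₁)| ≤ log P`, `α log P = π`);
* **`topG1522_bounds`** — the product profile `G_μ(t) = 𝓖_{jμ}(Q/t)·𝓦*ˣ_j(t)` (`Q ∈ [1, P]`) on `[1, P]`:
  differentiable, `‖G_μ‖ ≤ 146(1 + 7π)`, `‖G′_μ(t)‖ ≤ α(449(1 + 7π) + 146(3(1 + 7π) + 7))/t`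
  (`Section8AbelProfiles.frakgW_div_bounds`, `mul_bounds`);
* `ghj_eq_ghP` — the §12C selector `ghj j μ` is the §8d selector `ghP j μ` (`j = 1,2,3`, `μ = 6,7`);
* **`topG1522_at_rpow`** — at `t = P^z`, `0 ≤ θ − z ≤ 1`: `‖𝓖_{jμ}(P^θ/P^z)·𝓦*ˣ_j(P^z) − 𝔤𝔥_{jμ}(θ − z)·𝓦*ˣ_j(P^z)‖
  ≤ (1 + 7π)·C_p(c′)·𝓛⁻⁸` (sz-d19's `Section8ProfilesAtPz.profiles_six/seven`).

## References

* Y. Zhang, arXiv:2211.02515v1 (2022), §12 p. 68 (proof of Lemma 12.1), p. 73 (u049); §8 (8.11) p. 48, (8.13)–(8.18);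
  §2 (2.10), (2.13), (2.22). [cite: Zhang2022LandauSiegel, §12 (12.16) p.73]
-/

noncomputable section

open Complex Real ComplexConjugate
open Literature.NumberTheory.LFunctions.Zhang2022
open Literature.NumberTheory.LFunctions.Zhang2022.Skeleton
open Literature.NumberTheory.LFunctions.Zhang2022.Section8dStatements (ghP)

namespace Literature.NumberTheory.LFunctions.Zhang2022.Typed.Sec12C

section Weight

variable (c' : ℝ) {D : ℕ}

omit c' in
/-- `1 ≤ P″₁ = P^{0.496}Dt₀` once `𝓛 ≥ 3` (each factor is `≥ 1`). [cite: Zhang2022LandauSiegel, §12 p.67] -/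
theorem one_le_P1pp (hℓ : 3 ≤ ell D) : 1 ≤ P1pp D := by
  have hP : 1 ≤ bigP D ^ (0.496 : ℝ) := Real.one_le_rpow (Typed.Sec10C.one_le_bigP D) (by norm_num)
  have hD1 : (1 : ℝ) ≤ D := by
    have hD0 : (0 : ℝ) < D := by
      by_contra h
      have h0 : (D : ℝ) = 0 := le_antisymm (not_lt.mp h) (Nat.cast_nonneg D)
      have : ell D = 0 := by rw [ell, h0, Real.log_zero]
      linarith
    by_contra h
    have : ell D ≤ 0 := by rw [ell]; exact Real.log_nonpos hD0.le (not_le.mp h).le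
    linarith
  have ht : 1 ≤ t0 D := by rw [t0]; exact one_le_pow₀ (by linarith)
  rw [P1pp]
  calc (1 : ℝ) = 1 * 1 * 1 := by ring
    _ ≤ bigP D ^ (0.496 : ℝ) * D * t0 D := by gcongr

omit c' in
/-- `P″₁ ≤ P` once `𝓛 ≥ 3` (`log(P/P″₁) = 0.504𝓛⁹ − 𝓛 − 519 log 𝓛 ≥ 0`). [cite: Zhang2022LandauSiegel, §12 p.67] -/
theorem P1pp_le_bigP (hℓ : 3 ≤ ell D) : P1pp D ≤ bigP D := by
  have hℓ1 : 1 ≤ Real.log D := by rw [← ell]; linarith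
  have hP1 : 0 < P1pp D := Sec12D.P1pp_pos hℓ1
  have hP : 0 < bigP D := bigP_pos D
  have h := Sec12D.log_rpow_div_P1pp (D := D) hℓ1 1
  rw [Real.rpow_one, Skeleton.log_bigP] at h
  have hlog : Real.log (ell D) ≤ ell D := (Real.log_le_sub_one_of_pos (by linarith)).trans (by linarith)
  have h9 : 520 * ell D ≤ 0.504 * ell D ^ 9 := by
    have h8 : (3 : ℝ) ^ 8 ≤ ell D ^ 8 := pow_le_pow_left₀ (by norm_num) hℓ 8
    nlinarith
  have hnonneg : 0 ≤ Real.log (bigP D / P1pp D) := by rw [h]; nlinarith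
  have h1 : 1 ≤ bigP D / P1pp D := by
    by_contra hlt
    have := Real.log_neg (div_pos hP hP1) (not_le.mp hlt)
    linarith
  rwa [le_div_iff₀ hP1, one_mul] at h1

/-- **The exact weight as an exponential** (for `t > 0`, `P″₁ > 0`):
`𝓦*ˣ_j(t) = e^{−β₆ log(t/P″₁)}·(−1 + (β₆ − β_j)log(t/P″₁))`. [cite: Zhang2022LandauSiegel, §12 p.68 (proof of Lemma 12.1)] -/
theorem frakwStarEx_eq_exp (hP : 0 < P1pp D) (j : ℕ) {t : ℝ} (ht : 0 < t) :
    frakwStarEx c' D j t = cexp (-(beta6 D * ((Real.log (t / P1pp D) : ℝ) : ℂ))) *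
      (-1 + (beta6 D - betaJ c' D j) * (Real.log (t / P1pp D) : ℂ)) := by
  have hx : 0 < t / P1pp D := div_pos ht hP
  unfold frakwStarEx
  rw [Complex.cpow_def_of_ne_zero (Complex.ofReal_ne_zero.mpr hx.ne'), ← Complex.ofReal_log hx.le]
  congr 1
  ring_nf

omit c' in
/-- `d/dt log(t/c) = 1/t` (as a complex-valued function of the real variable `t`; `c, t > 0`). [folklore] -/
private theorem hasDerivAt_ofReal_log_div_const {c t : ℝ} (hc : 0 < c) (ht : 0 < t) :
    HasDerivAt (fun u : ℝ => ((Real.log (u / c) : ℝ) : ℂ)) ((t : ℂ)⁻¹) t := by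
  have h1 : HasDerivAt (fun u : ℝ => u / c) (1 / c) t := (hasDerivAt_id t).div_const c
  have h2 : HasDerivAt (fun u : ℝ => Real.log (u / c)) ((1 / c) / (t / c)) t :=
    h1.log (div_pos ht hc).ne'
  have h3 := h2.ofReal_comp
  refine h3.congr_deriv ?_
  have hc0 : (c : ℂ) ≠ 0 := by exact_mod_cast hc.ne'
  have ht0 : (t : ℂ) ≠ 0 := by exact_mod_cast ht.ne'
  push_cast
  field_simp

omit c' in
/-- `β₆ = β_μ` at `μ = 6` (dispatcher `betaMu`). [cite: Zhang2022LandauSiegel, §2 (2.22)] -/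
private theorem betaMu_six (D : ℕ) : betaMu D 6 = beta6 D := by
  unfold betaMu; norm_num

/-- **The exact weight on `[1, P]`: differentiable, `‖·‖ ≤ 1 + 7π`, `‖d/dt‖ ≤ α(3(1 + 7π) + 7)/t`** (exponential form;
`1 ≤ P″₁ ≤ P`, `5|c′|α𝓛 ≤ 1`). [cite: Zhang2022LandauSiegel, §12 p.68 (proof of Lemma 12.1), p.73] -/
theorem weightEx_bounds (j : ℕ) (hα : 0 < alpha D) (hℓ : 0 ≤ ell D) (hc : 5 * |c'| * alpha D * ell D ≤ 1)
    (hP1 : 1 ≤ P1pp D) (hP1P : P1pp D ≤ bigP D) {t : ℝ} (ht1 : 1 ≤ t) (htP : t ≤ bigP D) :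
    DifferentiableAt ℝ (fun u : ℝ => cexp (-(beta6 D * ((Real.log (u / P1pp D) : ℝ) : ℂ))) *
        (-1 + (beta6 D - betaJ c' D j) * (Real.log (u / P1pp D) : ℂ))) t ∧
      ‖cexp (-(beta6 D * ((Real.log (t / P1pp D) : ℝ) : ℂ))) *
          (-1 + (beta6 D - betaJ c' D j) * (Real.log (t / P1pp D) : ℂ))‖ ≤ 1 * (1 + 7 * π) ∧
      ‖deriv (fun u : ℝ => cexp (-(beta6 D * ((Real.log (u / P1pp D) : ℝ) : ℂ))) *
          (-1 + (beta6 D - betaJ c' D j) * (Real.log (u / P1pp D) : ℂ))) t‖ ≤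
        (3 * alpha D * (1 + 7 * π) + 1 * (7 * alpha D)) / t := by
  have ht : 0 < t := by linarith
  have hc0 : 0 < P1pp D := by linarith
  have hΛ0 : Real.log (bigP D) ≠ 0 := by
    intro h; rw [alpha, h, div_zero] at hα; exact lt_irrefl _ hα
  have hαΛ : alpha D * Real.log (bigP D) = π := by rw [alpha, div_mul_cancel₀ _ hΛ0]
  -- sizes of the shifts
  have h6 : ‖beta6 D‖ ≤ 3 * alpha D := by
    rw [← betaMu_six D]; exact (Section8AbelProfiles.norm_betaMu_bounds hα.le 6).2
  have hj : ‖betaJ c' D j‖ ≤ 4 * alpha D := Section8AbelProfiles.norm_betaJ_le c' hα.le hℓ hc j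
  have hB : ‖beta6 D - betaJ c' D j‖ ≤ 7 * alpha D := by
    refine (norm_sub_le _ _).trans ?_; linarith
  have hre : (beta6 D).re = 0 := by rw [← betaMu_six D]; exact Section8AbelProfiles.betaMu_re D 6
  have hlog : |Real.log (t / P1pp D)| ≤ Real.log (bigP D) :=
    Section8AbelProfiles.abs_log_div_le ht1 htP hP1 hP1P
  -- the two factors
  have hL := hasDerivAt_ofReal_log_div_const hc0 ht
  have hf : HasDerivAt (fun u : ℝ => cexp (-(beta6 D * ((Real.log (u / P1pp D) : ℝ) : ℂ))))
      (cexp (-(beta6 D * ((Real.log (t / P1pp D) : ℝ) : ℂ))) * (-(beta6 D * (t : ℂ)⁻¹))) t :=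
    (hL.const_mul (beta6 D)).neg.cexp
  have hg : HasDerivAt (fun u : ℝ => -1 + (beta6 D - betaJ c' D j) * (Real.log (u / P1pp D) : ℂ))
      ((beta6 D - betaJ c' D j) * (t : ℂ)⁻¹) t := (hL.const_mul _).const_add _
  have nf : ‖cexp (-(beta6 D * ((Real.log (t / P1pp D) : ℝ) : ℂ)))‖ ≤ 1 :=
    (Section8AbelProfiles.norm_cexp_neg_mul_ofReal_of_re_eq_zero hre _).le
  have nf' : ‖deriv (fun u : ℝ => cexp (-(beta6 D * ((Real.log (u / P1pp D) : ℝ) : ℂ)))) t‖ ≤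
      3 * alpha D / t := by
    rw [hf.deriv, norm_mul, norm_neg, norm_mul, norm_inv, Complex.norm_real, Real.norm_of_nonneg ht.le]
    calc ‖cexp (-(beta6 D * ((Real.log (t / P1pp D) : ℝ) : ℂ)))‖ * (‖beta6 D‖ * t⁻¹)
        ≤ 1 * (3 * alpha D * t⁻¹) := by gcongr
      _ = 3 * alpha D / t := by ring
  have ng : ‖-1 + (beta6 D - betaJ c' D j) * (Real.log (t / P1pp D) : ℂ)‖ ≤ 1 + 7 * π := by
    calc ‖-1 + (beta6 D - betaJ c' D j) * (Real.log (t / P1pp D) : ℂ)‖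
        ≤ ‖(-1 : ℂ)‖ + ‖beta6 D - betaJ c' D j‖ * ‖(Real.log (t / P1pp D) : ℂ)‖ := by
          refine (norm_add_le _ _).trans ?_; rw [norm_mul]
      _ ≤ 1 + 7 * alpha D * Real.log (bigP D) := by
          rw [norm_neg, norm_one, Complex.norm_real, Real.norm_eq_abs]
          gcongr
      _ = 1 + 7 * π := by rw [mul_assoc, hαΛ]
  have ng' : ‖deriv (fun u : ℝ => -1 + (beta6 D - betaJ c' D j) * (Real.log (u / P1pp D) : ℂ)) t‖ ≤
      7 * alpha D / t := by
    rw [hg.deriv, norm_mul, norm_inv, Complex.norm_real, Real.norm_of_nonneg ht.le]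
    calc ‖beta6 D - betaJ c' D j‖ * t⁻¹ ≤ 7 * alpha D * t⁻¹ := by gcongr
      _ = 7 * alpha D / t := by ring
  exact Section8AbelProfiles.mul_bounds hf.differentiableAt hg.differentiableAt nf ng nf' ng' zero_le_one

/-- **The top-range profile of `S_j(𝐚₁₅,𝐚₂₂)` (exact reading) as a function of `t`**: for `Q ∈ [1, P]`,
`G_μ(t) = 𝓖_{jμ}(Q/t)·𝓦*ˣ_j(t)` on `[1, P]` is differentiable with `‖G_μ‖ ≤ 146(1 + 7π)` and
`‖G′_μ(t)‖ ≤ α(449(1 + 7π) + 146(3(1 + 7π) + 7))/t`. [cite: Zhang2022LandauSiegel, §12 (12.16) p.73] -/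
theorem topG1522_bounds (j μ : ℕ) (hα : 0 < alpha D) (hℓ : 0 ≤ ell D)
    (hc : 5 * |c'| * alpha D * ell D ≤ 1) {Q : ℝ} (hQ1 : 1 ≤ Q) (hQP : Q ≤ bigP D)
    (hP1 : 1 ≤ P1pp D) (hP1P : P1pp D ≤ bigP D) {t : ℝ} (ht1 : 1 ≤ t) (htP : t ≤ bigP D) :
    DifferentiableAt ℝ (fun u : ℝ => frakgW c' D j μ (Q / u) *
        (cexp (-(beta6 D * ((Real.log (u / P1pp D) : ℝ) : ℂ))) *
          (-1 + (beta6 D - betaJ c' D j) * (Real.log (u / P1pp D) : ℂ)))) t ∧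
      ‖frakgW c' D j μ (Q / t) *
          (cexp (-(beta6 D * ((Real.log (t / P1pp D) : ℝ) : ℂ))) *
            (-1 + (beta6 D - betaJ c' D j) * (Real.log (t / P1pp D) : ℂ)))‖ ≤ 146 * (1 * (1 + 7 * π)) ∧
      ‖deriv (fun u : ℝ => frakgW c' D j μ (Q / u) *
          (cexp (-(beta6 D * ((Real.log (u / P1pp D) : ℝ) : ℂ))) *
            (-1 + (beta6 D - betaJ c' D j) * (Real.log (u / P1pp D) : ℂ)))) t‖ ≤
        (449 * alpha D * (1 * (1 + 7 * π)) + 146 * (3 * alpha D * (1 + 7 * π) + 1 * (7 * alpha D))) / t := by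
  have hΛ0 : Real.log (bigP D) ≠ 0 := by
    intro h; rw [alpha, h, div_zero] at hα; exact lt_irrefl _ hα
  have hαΛ : alpha D * Real.log (bigP D) ≤ 4 := by
    have : alpha D * Real.log (bigP D) = π := by rw [alpha, div_mul_cancel₀ _ hΛ0]
    rw [this]; linarith [Real.pi_lt_four]
  obtain ⟨d1, n1, n1'⟩ := Section8AbelProfiles.frakgW_div_bounds c' j μ hα hℓ hc hQ1 hQP ht1 htP hαΛ
  obtain ⟨d2, n2, n2'⟩ := weightEx_bounds c' j hα hℓ hc hP1 hP1P ht1 htP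
  exact Section8AbelProfiles.mul_bounds d1 d2 n1 n2 n1' n2' (by norm_num)

end Weight

/-! ### The selector bridge and the value of the profile at `t = P^z` -/

section AtPz

variable (c' : ℝ) {D : ℕ}

omit c' in
/-- The §12C dispatcher `ghj j μ` is the §8d dispatcher `ghP j μ` for `j = 1,2,3`, `μ = 6,7`.
[cite: Zhang2022LandauSiegel, §8 (8.13)–(8.18) p.48] -/
theorem ghj_eq_ghP {j : ℕ} (hj : j ∈ ({1, 2, 3} : Finset ℕ)) : ghj j 6 = ghP j 6 ∧ ghj j 7 = ghP j 7 := by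
  simp only [Finset.mem_insert, Finset.mem_singleton] at hj
  rcases hj with rfl | rfl | rfl <;> exact ⟨by simp [ghj, ghP], by simp [ghj, ghP]⟩

/-- **The profile at `t = P^z` against the printed integrand** (`μ = 6`, `θ − z ∈ [0, 1]`, `D ≥ 3`):
`‖𝓖_{j6}(P^θ/P^z)·w − 𝔤𝔥_{j6}(θ − z)·w‖ ≤ C_p(c′)𝓛⁻⁸·‖w‖`. [cite: Zhang2022LandauSiegel, §12 (12.16) p.73] -/
theorem frakgW_six_at_rpow (hD3 : 3 ≤ D) {j : ℕ} (hj : j ∈ ({1, 2, 3} : Finset ℕ)) {θ z : ℝ}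
    (hz0 : 0 ≤ θ - z) (hz1 : θ - z ≤ 1) (w : ℂ) :
    ‖frakgW c' D j 6 (bigP D ^ θ / bigP D ^ z) * w - ghj j 6 (θ - z) * w‖ ≤
      (75 * |c'| * π ^ 2 + 40 * |c'| ^ 2 * π ^ 3) * (ell D ^ 8)⁻¹ * ‖w‖ := by
  have hrpow : bigP D ^ θ / bigP D ^ z = bigP D ^ (θ - z) := by rw [Real.rpow_sub (bigP_pos D)]
  obtain ⟨-, hg⟩ := Section8ProfilesAtPz.profiles_six c' hD3 hj hz0 hz1
  rw [hrpow, (ghj_eq_ghP hj).1, ← sub_mul, norm_mul]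
  exact mul_le_mul_of_nonneg_right hg (norm_nonneg _)

/-- **The profile at `t = P^z` against the printed integrand** (`μ = 7`). [cite: Zhang2022LandauSiegel, §12 (12.16) p.73] -/
theorem frakgW_seven_at_rpow (hD3 : 3 ≤ D) {j : ℕ} (hj : j ∈ ({1, 2, 3} : Finset ℕ)) {θ z : ℝ}
    (hz0 : 0 ≤ θ - z) (hz1 : θ - z ≤ 1) (w : ℂ) :
    ‖frakgW c' D j 7 (bigP D ^ θ / bigP D ^ z) * w - ghj j 7 (θ - z) * w‖ ≤
      (75 * |c'| * π ^ 2 + 40 * |c'| ^ 2 * π ^ 3) * (ell D ^ 8)⁻¹ * ‖w‖ := by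
  have hrpow : bigP D ^ θ / bigP D ^ z = bigP D ^ (θ - z) := by rw [Real.rpow_sub (bigP_pos D)]
  obtain ⟨-, hg⟩ := Section8ProfilesAtPz.profiles_seven c' hD3 hj hz0 hz1
  rw [hrpow, (ghj_eq_ghP hj).2, ← sub_mul, norm_mul]
  exact mul_le_mul_of_nonneg_right hg (norm_nonneg _)

/-- `‖𝓦*ˣ_j(P^z)‖ ≤ 1 + 7π` for `0 ≤ z ≤ 1` (large `D`: `𝓛 ≥ 3`, `5|c′|α𝓛 ≤ 1`).
[cite: Zhang2022LandauSiegel, §12 p.68 (proof of Lemma 12.1)] -/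
theorem norm_frakwStarEx_rpow_le (j : ℕ) (hℓ3 : 3 ≤ ell D) (hc : 5 * |c'| * alpha D * ell D ≤ 1)
    {z : ℝ} (hz0 : 0 ≤ z) (hz1 : z ≤ 1) :
    ‖frakwStarEx c' D j (bigP D ^ z)‖ ≤ 1 + 7 * π := by
  have hℓ1 : 1 ≤ Real.log D := by rw [← ell]; linarith
  have hα : 0 < alpha D := Sec12D.alpha_pos_of_log hℓ1
  have hP1 := one_le_P1pp (D := D) hℓ3
  have hP1P := P1pp_le_bigP (D := D) hℓ3
  have hP : 1 ≤ bigP D := Typed.Sec10C.one_le_bigP D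
  have ht1 : 1 ≤ bigP D ^ z := Real.one_le_rpow hP hz0
  have htP : bigP D ^ z ≤ bigP D := by
    calc bigP D ^ z ≤ bigP D ^ (1 : ℝ) := Real.rpow_le_rpow_of_exponent_le hP hz1
      _ = bigP D := Real.rpow_one _
  obtain ⟨-, n, -⟩ := weightEx_bounds c' j hα (by linarith) hc hP1 hP1P ht1 htP
  rw [frakwStarEx_eq_exp c' (by linarith) j (by linarith)]
  linarith

end AtPz

end Literature.NumberTheory.LFunctions.Zhang2022.Typed.Sec12C
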